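/-
Origin: expansion seat `planner-pub-hodgecm-toy-g2-0`, handover #32 2026-08-18T10:04:57Z (`HOME/pub-hodgecm-toy-g2/lean/ToyG2/ProdStepPrep.lean`, md5 9a626303, 149 lines);
landed by the gen-7 packager in gate run 28 as `HodgeCM/Model/ToyG2/ProdStepPrep.lean` (import ^import ToyG2\.→import HodgeCM.Model.ToyG2. ×1).
-/
/-
# HodgeCM.Model.ToyG2.ProdStepPrep — the product step `GenProdStep`, all but the bidegree grouping

Generation 2 of the `pub-hodgecm-toy` lineage (seat `planner-pub-hodgecm-toy-g2-0`), DESIGN.md §9·UPDATE 10:15Z, GEN-3 ITEM 1 steps (0), (3)–(5).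

For good `S, X₁, X₂`, an admissible `ψ : H¹(X₁ × X₂) → H¹S` and `z ∈ ⋀^k H¹S` the bilinear functional
`prodF a b := tr_S((ψ₁^* a ∧ ψ₂^* b) ∧ z)` (`ψ₁ = ψ ∘ inl`, `ψ₂ = ψ ∘ inr`) satisfies
* `Obj₂.Adm.inl`, `Obj₂.Adm.inr`: block-admissibility restricts to the factors;
* `trOf_map_kun`: `tr_S(ψ^*(a ⊠ b) ∧ z) = prodF a b` (and `trOf_map_lift_kun` for tensors);
* `prodF_left`, `prodF_right`: `GenRadKilled S X₁` (resp. `S X₂`) makes `prodF` vanish on `leftRad X₁ i₁ j₁ × everything`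
  (resp. `everything × leftRad X₂ i₂ j₂`) — associativity / graded commutativity of the trace pairing (`trOf_wedge_assoc`,
  `trOf_wedge_wedge_comm`);
* hence, by the tensor radical lemma (`lift_eq_zero_of_pairings`), **`prodStep_group`**: `tr_S(ψ^*(lift kun t) ∧ z) = 0` for every
  tensor `t ∈ ⋀^{i₁}H¹X₁ ⊗ ⋀^{i₂}H¹X₂` killed by all `tr₁(· ∧ w₁) ⊗ tr₂(· ∧ w₂)` — the conclusion of `GenProdStep` for one bidegree group.
What remains of `GenProdStep` is the bidegree grouping of an arbitrary `y ∈ leftRad (X₁ × X₂) i j` (DESIGN.md §9·UPDATE 10:15Z (1)–(2)).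
-/
import Mathlib
import Summits.HodgeConjecture.HodgeCM.Model.ToyG2.RadicalProd
import Summits.HodgeConjecture.HodgeCM.Model.ToyG2.TensorRadical

namespace HodgeCM.ToyG2

open HodgeCM.Toy HodgeCM.Toy.CMPresentation
open Literature.AlgebraicGeometry.Motives
open scoped TensorProduct
open exteriorPower Obj₂

noncomputable section

/-! ### (0) block-admissibility restricts to the factors -/

/-- (Ported verbatim from the HodgeCMPerL package; no docstring in the source.) -/
theorem Obj₂.Adm.inl {S X₁ X₂ : Obj₂} {ψ : (X₁.prod X₂).L →ₗ[ℚ] S.L} (h : Adm S (X₁.prod X₂) ψ) :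
    Adm S X₁ (ψ ∘ₗ X₁.toObj.inlL X₂.toObj) := by
  intro u hu
  rcases h (Sum.inl u) hu with h0 | ⟨u', hu', g, hg, ht⟩
  · left
    rw [LinearMap.comp_assoc, ← inclAt_prod_inl]
    exact h0
  · right
    refine ⟨u', hu', g, ?_, ht⟩
    rw [LinearMap.comp_assoc, ← inclAt_prod_inl]
    exact hg

/-- (Ported verbatim from the HodgeCMPerL package; no docstring in the source.) -/
theorem Obj₂.Adm.inr {S X₁ X₂ : Obj₂} {ψ : (X₁.prod X₂).L →ₗ[ℚ] S.L} (h : Adm S (X₁.prod X₂) ψ) :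
    Adm S X₂ (ψ ∘ₗ X₁.toObj.inrL X₂.toObj) := by
  intro u hu
  rcases h (Sum.inr u) hu with h0 | ⟨u', hu', g, hg, ht⟩
  · left
    rw [LinearMap.comp_assoc, ← inclAt_prod_inr]
    exact h0
  · right
    refine ⟨u', hu', g, ?_, ht⟩
    rw [LinearMap.comp_assoc, ← inclAt_prod_inr]
    exact hg

/-! ### graded commutativity under a third factor -/

/-- (Ported verbatim from the HodgeCMPerL package; no docstring in the source.) -/
theorem trOf_wedge_wedge_comm (X : Obj₂) {a b c : ℕ} (x : ⋀[ℚ]^a X.L) (y : ⋀[ℚ]^b X.L) (z : ⋀[ℚ]^c X.L) :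
    trOf X (a + b + c) (wedge ℚ X.L (a + b) c (wedge ℚ X.L a b x y) z)
      = (-1 : ℚ) ^ (a * b) * trOf X (b + a + c) (wedge ℚ X.L (b + a) c (wedge ℚ X.L b a y x) z) := by
  rw [trOf_congr X (by rw [Nat.add_comm a b] : a + b + c = b + a + c)
      (z' := ((-1 : ℚ) ^ (a * b)) • wedge ℚ X.L (b + a) c (wedge ℚ X.L b a y x) z)
      (by rw [wedge_coe, wedge_coe, Submodule.coe_smul, wedge_coe, wedge_coe, mul_comm_graded x.2 y.2, smul_mul_assoc]),
    map_smul, smul_eq_mul]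

/-! ### (3) the functional of the product step -/

section ProdF

variable (S X₁ X₂ : Obj₂) (ψ : (X₁.prod X₂).L →ₗ[ℚ] S.L) (i₁ i₂ k : ℕ) (z : ⋀[ℚ]^k S.L)

/-- `prodF a b = tr_S((ψ₁^* a ∧ ψ₂^* b) ∧ z)` -/
def prodF : (⋀[ℚ]^i₁ X₁.L) →ₗ[ℚ] (⋀[ℚ]^i₂ X₂.L) →ₗ[ℚ] ℚ :=
  ((wedge ℚ S.L i₁ i₂).compl₁₂ (map i₁ (ψ ∘ₗ X₁.toObj.inlL X₂.toObj)) (map i₂ (ψ ∘ₗ X₁.toObj.inrL X₂.toObj))).compr₂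
    ((trOf S (i₁ + i₂ + k)) ∘ₗ (wedge ℚ S.L (i₁ + i₂) k).flip z)

/-- (Ported verbatim from the HodgeCMPerL package; no docstring in the source.) -/
theorem prodF_apply (a : ⋀[ℚ]^i₁ X₁.L) (b : ⋀[ℚ]^i₂ X₂.L) :
    prodF S X₁ X₂ ψ i₁ i₂ k z a b
      = trOf S (i₁ + i₂ + k) (wedge ℚ S.L (i₁ + i₂) k
          (wedge ℚ S.L i₁ i₂ (map i₁ (ψ ∘ₗ X₁.toObj.inlL X₂.toObj) a) (map i₂ (ψ ∘ₗ X₁.toObj.inrL X₂.toObj) b)) z) :=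
  rfl

/-- `tr_S(ψ^*(a ⊠ b) ∧ z) = prodF a b` -/
theorem trOf_map_kun (a : ⋀[ℚ]^i₁ X₁.L) (b : ⋀[ℚ]^i₂ X₂.L) :
    trOf S (i₁ + i₂ + k) (wedge ℚ S.L (i₁ + i₂) k (map (i₁ + i₂) ψ (kun X₁ X₂ i₁ i₂ a b)) z)
      = prodF S X₁ X₂ ψ i₁ i₂ k z a b := by
  rw [map_kun, prodF_apply]

/-- the same for tensors -/
theorem trOf_map_lift_kun (t : (⋀[ℚ]^i₁ X₁.L) ⊗[ℚ] (⋀[ℚ]^i₂ X₂.L)) :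
    trOf S (i₁ + i₂ + k) (wedge ℚ S.L (i₁ + i₂) k (map (i₁ + i₂) ψ (TensorProduct.lift (kun X₁ X₂ i₁ i₂) t)) z)
      = TensorProduct.lift (prodF S X₁ X₂ ψ i₁ i₂ k z) t := by
  induction t using TensorProduct.induction_on with
  | zero => simp only [map_zero, LinearMap.zero_apply]
  | tmul a b => rw [TensorProduct.lift.tmul, TensorProduct.lift.tmul, trOf_map_kun]
  | add x y hx hy => simp only [map_add, LinearMap.add_apply, hx, hy]

variable {S X₁ X₂ ψ i₁ i₂ k z}

/-- (4, h₁) `GenRadKilled S X₁` ⇒ `prodF` vanishes on `leftRad X₁ i₁ j₁ × everything` -/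
theorem prodF_left (G₁ : GenRadKilled S X₁) (hψ : Adm S (X₁.prod X₂) ψ) {j₁ : ℕ} (hj : i₁ + j₁ = sdeg X₁.s X₁.leaf)
    {r : ⋀[ℚ]^i₁ X₁.L} (hr : r ∈ leftRad X₁ i₁ j₁) (b : ⋀[ℚ]^i₂ X₂.L) :
    prodF S X₁ X₂ ψ i₁ i₂ k z r b = 0 := by
  rw [prodF_apply, trOf_wedge_assoc]
  exact G₁ i₁ j₁ hj _ hψ.inl (i₂ + k) _ r hr

/-- (4, h₂) `GenRadKilled S X₂` ⇒ `prodF` vanishes on `everything × leftRad X₂ i₂ j₂` -/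
theorem prodF_right (G₂ : GenRadKilled S X₂) (hψ : Adm S (X₁.prod X₂) ψ) {j₂ : ℕ} (hj : i₂ + j₂ = sdeg X₂.s X₂.leaf)
    (a : ⋀[ℚ]^i₁ X₁.L) {r : ⋀[ℚ]^i₂ X₂.L} (hr : r ∈ leftRad X₂ i₂ j₂) :
    prodF S X₁ X₂ ψ i₁ i₂ k z a r = 0 := by
  rw [prodF_apply, trOf_wedge_wedge_comm, trOf_wedge_assoc]
  rw [G₂ i₂ j₂ hj _ hψ.inr (i₁ + k) _ r hr, mul_zero]

/-- **(5) the product step for one bidegree group**: `tr_S(ψ^*(lift kun t) ∧ z) = 0` for every tensor `t` killed by all products of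
representable functionals `tr₁(· ∧ w₁) ⊗ tr₂(· ∧ w₂)` (complementary degrees `i₁ + j₁ = 2 dim X₁`, `i₂ + j₂ = 2 dim X₂`) -/
theorem prodStep_group (G₁ : GenRadKilled S X₁) (G₂ : GenRadKilled S X₂) (hψ : Adm S (X₁.prod X₂) ψ)
    {j₁ j₂ : ℕ} (hj₁ : i₁ + j₁ = sdeg X₁.s X₁.leaf) (hj₂ : i₂ + j₂ = sdeg X₂.s X₂.leaf)
    (t : (⋀[ℚ]^i₁ X₁.L) ⊗[ℚ] (⋀[ℚ]^i₂ X₂.L))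
    (ht : ∀ (w₁ : ⋀[ℚ]^j₁ X₁.L) (w₂ : ⋀[ℚ]^j₂ X₂.L),
      TensorProduct.lift (mulForm ((trPairing X₁ i₁ j₁).flip w₁) ((trPairing X₂ i₂ j₂).flip w₂)) t = 0) :
    trOf S (i₁ + i₂ + k) (wedge ℚ S.L (i₁ + i₂) k (map (i₁ + i₂) ψ (TensorProduct.lift (kun X₁ X₂ i₁ i₂) t)) z) = 0 := by
  haveI : Module.Free ℚ (↥(⋀[ℚ]^j₁ X₁.L)) := Module.Free.of_divisionRing ℚ _
  haveI : Module.Finite ℚ (↥(⋀[ℚ]^j₁ X₁.L)) := exteriorPower.instFinite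
  haveI : Module.Free ℚ (↥(⋀[ℚ]^j₂ X₂.L)) := Module.Free.of_divisionRing ℚ _
  haveI : Module.Finite ℚ (↥(⋀[ℚ]^j₂ X₂.L)) := exteriorPower.instFinite
  rw [trOf_map_lift_kun]
  exact lift_eq_zero_of_pairings (trPairing X₁ i₁ j₁) (trPairing X₂ i₂ j₂) (prodF S X₁ X₂ ψ i₁ i₂ k z)
    (fun r hr b => prodF_left G₁ hψ hj₁ hr b) (fun r hr a => prodF_right G₂ hψ hj₂ a hr) t ht

/-- the same for a finite sum of pure tensors (the form delivered by a bidegree grouping of a spanning family) -/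
theorem prodStep_group_sum (G₁ : GenRadKilled S X₁) (G₂ : GenRadKilled S X₂) (hψ : Adm S (X₁.prod X₂) ψ)
    {j₁ j₂ : ℕ} (hj₁ : i₁ + j₁ = sdeg X₁.s X₁.leaf) (hj₂ : i₂ + j₂ = sdeg X₂.s X₂.leaf)
    {ι : Type*} (s : Finset ι) (a : ι → ⋀[ℚ]^i₁ X₁.L) (b : ι → ⋀[ℚ]^i₂ X₂.L)
    (ht : ∀ (w₁ : ⋀[ℚ]^j₁ X₁.L) (w₂ : ⋀[ℚ]^j₂ X₂.L),
      ∑ α ∈ s, trPairing X₁ i₁ j₁ (a α) w₁ * trPairing X₂ i₂ j₂ (b α) w₂ = 0) :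
    ∑ α ∈ s, trOf S (i₁ + i₂ + k) (wedge ℚ S.L (i₁ + i₂) k (map (i₁ + i₂) ψ (kun X₁ X₂ i₁ i₂ (a α) (b α))) z) = 0 := by
  haveI : Module.Free ℚ (↥(⋀[ℚ]^j₁ X₁.L)) := Module.Free.of_divisionRing ℚ _
  haveI : Module.Finite ℚ (↥(⋀[ℚ]^j₁ X₁.L)) := exteriorPower.instFinite
  haveI : Module.Free ℚ (↥(⋀[ℚ]^j₂ X₂.L)) := Module.Free.of_divisionRing ℚ _
  haveI : Module.Finite ℚ (↥(⋀[ℚ]^j₂ X₂.L)) := exteriorPower.instFinite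
  simp_rw [trOf_map_kun]
  exact sum_eq_zero_of_pairings (trPairing X₁ i₁ j₁) (trPairing X₂ i₂ j₂) (prodF S X₁ X₂ ψ i₁ i₂ k z)
    (fun r hr b => prodF_left G₁ hψ hj₁ hr b) (fun r hr a => prodF_right G₂ hψ hj₂ a hr) s a b ht

end ProdF

end

end HodgeCM.ToyG2
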